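import Literature.Computability.QuantumComplexity.HybridArgument
import Literature.Computability.Cryptography.QubitRegisterProofs
import HarnessLib

/-!
# Approximate implementation of unitaries on a subspace: an error calculus for quantum circuits

Topic `Literature/Computability/QuantumComplexity`; infrastructure for the discharge of
`ajl_jonesApproxProblem_mem_PromiseBQP` (`JonesInBQP.lean`), whose algorithm (Aharonov–Jones–Landau
2009, §3) uses unitaries with golden-ratio entries that no Clifford+`T` circuit implements exactly,
so that gates have to be *approximated* and the errors accumulated (Bernstein–Vazirani 1997, §6,
"the error in a sequence of unitaries is at most the sum of the errors"; Nielsen–Chuang 2010,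
§4.5.3, Box 4.1, eq. (4.63) `E(U_m ⋯ U_1, V_m ⋯ V_1) ≤ Σ_j E(U_j, V_j)` and eq. (4.62)
`|P_U − P_V| ≤ 2 E(U, V)`).

In the tree's circuit model (`QReg N = Fin N → Bool`, state vectors `QReg N → ℂ`, matrices acting by
`*ᵥ`, `l2Norm` of `HybridArgument.lean`) we set up the calculus in the form needed for gates that
are implemented with the help of *clean ancillas* (exact only on inputs whose ancilla wires read `0`,
and returning them to `0` only approximately — the situation of oblivious amplitude amplification):

* `SuppIn P ψ` — the state `ψ` is supported on the set `P` of basis labels (e.g. "all ancilla wires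
  are `0`"); `PreservesSupp P U`; `IsContraction M` (`‖Mψ‖₂ ≤ ‖ψ‖₂`, e.g. unitaries);
* `ImplOn P M U δ` — **`M` implements `U` on `P`-supported inputs up to `δ`**:
  `‖Mψ − Uψ‖₂ ≤ δ‖ψ‖₂` whenever `SuppIn P ψ`;
* the calculus: `ImplOn.mono`, `.of_subset`, `.refl`, `.trans`, **`.mul`** (errors add along a
  product when the actual factors are contractions and the ideal ones are `P`-preserving
  contractions), **`.listProd`** (over a list of `ApproxStep`s) (the same for a list of factors, error `= Σ δ_j`);
* **transport along a gate placement** `ImplOn.placeGate`: if `M` implements `U` on `P` up to `δ`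
  on `k` wires then `placeGate e M` implements `placeGate e U` up to the same `δ` on the pulled-back
  support condition `{x | x ∘ e ∈ P}` (the fibrewise structure `placeGate e A = A ⊗ 1`,
  `placeGate_eq_reindex_kronecker`); with `IsContraction.placeGate`, `PreservesSupp.placeGate` and
  `preservesSupp_placeGate_of_offWires` (a placed gate preserves every support condition that only
  reads wires off its placement);
* **statistics** `abs_sum_normSq_sub_le_of_implOn`: for unitary `M`, `U` and a `P`-supported unit
  vector `ψ`, every event has `|P_M(E) − P_U(E)| ≤ δ` (via BBBV's Thm. 3.1 in the sharp one-event
  form `abs_sum_normSq_sub_le`).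

## References

* E. Bernstein, U. Vazirani, *Quantum complexity theory*, SIAM J. Comput. 26 (1997), §6
  (accumulation of approximation errors) [BernsteinVazirani1997].
* M. A. Nielsen, I. L. Chuang, *Quantum Computation and Quantum Information*, CUP 2010, §4.5.3,
  Box 4.1, eqs. (4.61)–(4.63) [NielsenChuang2010].
* C. H. Bennett, E. Bernstein, G. Brassard, U. Vazirani, SIAM J. Comput. 26 (1997), Thm. 3.1
  (close states give close statistics) [BennettBernsteinBrassardVazirani1997].
-/

noncomputable section

namespace Literature.Computability.QuantumComplexity

open Matrix Finset
open scoped Kronecker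

variable {N : ℕ}

/-! ### Supports, contractions, and the implementation relation -/

/-- The state vector `ψ` is supported on the set `P` of basis labels: its amplitudes vanish off `P`
(typically `P` = "all ancilla wires read `0`"). [folklore] -/
def SuppIn (P : Set (Cryptography.QReg N)) (ψ : Cryptography.QReg N → ℂ) : Prop :=
  ∀ x, x ∉ P → ψ x = 0

/-- The matrix `U` maps `P`-supported states to `P`-supported states. [folklore] -/
def PreservesSupp (P : Set (Cryptography.QReg N)) (U : Matrix (Cryptography.QReg N) (Cryptography.QReg N) ℂ) : Prop :=
  ∀ ψ, SuppIn P ψ → SuppIn P (U *ᵥ ψ)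

/-- `M` is a contraction for the `ℓ²`-norm: `‖Mψ‖₂ ≤ ‖ψ‖₂` (every unitary is one).
[cite: NielsenChuang2010, §2.1.6] -/
def IsContraction (M : Matrix (Cryptography.QReg N) (Cryptography.QReg N) ℂ) : Prop :=
  ∀ ψ, l2Norm (M *ᵥ ψ) ≤ l2Norm ψ

/-- **Approximate implementation on a subspace.** `M` implements `U` on `P`-supported inputs up to
`δ`: `‖Mψ − Uψ‖₂ ≤ δ ‖ψ‖₂` for every `ψ` supported on `P`. For `P = univ` this is the operator-norm
bound `‖M − U‖ ≤ δ`, Nielsen–Chuang's `E(M, U) ≤ δ`. [cite: NielsenChuang2010, §4.5.3 Box 4.1 eq. (4.61)] -/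
def ImplOn (P : Set (Cryptography.QReg N)) (M U : Matrix (Cryptography.QReg N) (Cryptography.QReg N) ℂ) (δ : ℝ) : Prop :=
  ∀ ψ, SuppIn P ψ → l2Norm (M *ᵥ ψ - U *ᵥ ψ) ≤ δ * l2Norm ψ

section Basic

variable {P P' : Set (Cryptography.QReg N)} {M U V M₁ M₂ U₁ U₂ : Matrix (Cryptography.QReg N) (Cryptography.QReg N) ℂ}
  {δ δ' δ₁ δ₂ : ℝ}

/-- Every state is supported on `univ`. [folklore] -/
theorem suppIn_univ (ψ : Cryptography.QReg N → ℂ) : SuppIn Set.univ ψ := fun _ h => (h (Set.mem_univ _)).elim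

/-- `SuppIn P ψ` is Mathlib's `Function.support ψ ⊆ P`. [folklore] -/
theorem suppIn_iff_support_subset {P : Set (Cryptography.QReg N)} {ψ : Cryptography.QReg N → ℂ} :
    SuppIn P ψ ↔ Function.support ψ ⊆ P :=
  ⟨fun h _ hx => by_contra fun hxP => hx (h _ hxP), fun h _ hxP => Function.notMem_support.1 fun hx => hxP (h hx)⟩

/-- Supports are monotone in the set. [folklore] -/
theorem SuppIn.mono {ψ : Cryptography.QReg N → ℂ} (h : SuppIn P ψ) (hPP' : P ⊆ P') : SuppIn P' ψ :=
  fun x hx => h x fun hx' => hx (hPP' hx')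

/-- The zero vector is supported everywhere. [folklore] -/
theorem suppIn_zero (P : Set (Cryptography.QReg N)) : SuppIn P (0 : Cryptography.QReg N → ℂ) := fun _ _ => rfl

/-- Supports are closed under addition. [folklore] -/
theorem SuppIn.add {ψ φ : Cryptography.QReg N → ℂ} (h₁ : SuppIn P ψ) (h₂ : SuppIn P φ) : SuppIn P (ψ + φ) :=
  fun x hx => by rw [Pi.add_apply, h₁ x hx, h₂ x hx, add_zero]

/-- Supports are closed under subtraction. [folklore] -/
theorem SuppIn.sub {ψ φ : Cryptography.QReg N → ℂ} (h₁ : SuppIn P ψ) (h₂ : SuppIn P φ) : SuppIn P (ψ - φ) :=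
  fun x hx => by rw [Pi.sub_apply, h₁ x hx, h₂ x hx, sub_zero]

/-- Supports are closed under scalars. [folklore] -/
theorem SuppIn.smul {ψ : Cryptography.QReg N → ℂ} (h : SuppIn P ψ) (c : ℂ) : SuppIn P (c • ψ) :=
  fun x hx => by rw [Pi.smul_apply, h x hx, smul_zero]

/-- A basis state `|x⟩` is supported on any set containing `x`. [folklore] -/
theorem suppIn_basisState {x : Cryptography.QReg N} (hx : x ∈ P) : SuppIn P (Cryptography.basisState x) := by
  intro y hy
  rw [Cryptography.basisState_apply, if_neg]
  rintro rfl; exact hy hx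

/-- Unitaries are contractions (indeed isometries). [cite: NielsenChuang2010, §2.1.6] -/
theorem isContraction_of_mem_unitaryGroup (hU : U ∈ Matrix.unitaryGroup (Cryptography.QReg N) ℂ) : IsContraction U :=
  fun ψ => (l2Norm_mulVec_of_mem_unitaryGroup hU ψ).le

/-- The identity is a contraction. [folklore] -/
theorem isContraction_one : IsContraction (1 : Matrix (Cryptography.QReg N) (Cryptography.QReg N) ℂ) :=
  fun ψ => by rw [Matrix.one_mulVec]

/-- Contractions compose. [folklore] -/
theorem IsContraction.mul (h₂ : IsContraction M₂) (h₁ : IsContraction M₁) : IsContraction (M₂ * M₁) :=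
  fun ψ => by rw [← Matrix.mulVec_mulVec]; exact (h₂ _).trans (h₁ ψ)

/-- The identity preserves every support condition. [folklore] -/
theorem preservesSupp_one (P : Set (Cryptography.QReg N)) : PreservesSupp P (1 : Matrix (Cryptography.QReg N) (Cryptography.QReg N) ℂ) :=
  fun ψ h => by rwa [Matrix.one_mulVec]

/-- Support-preserving matrices compose. [folklore] -/
theorem PreservesSupp.mul (h₂ : PreservesSupp P U₂) (h₁ : PreservesSupp P U₁) : PreservesSupp P (U₂ * U₁) :=
  fun ψ h => by rw [← Matrix.mulVec_mulVec]; exact h₂ _ (h₁ ψ h)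

/-- The error bound of an implementation may be enlarged. [folklore] -/
theorem ImplOn.mono (h : ImplOn P M U δ) (hδ : δ ≤ δ') : ImplOn P M U δ' :=
  fun ψ hψ => (h ψ hψ).trans (mul_le_mul_of_nonneg_right hδ (l2Norm_nonneg ψ))

/-- The support condition of an implementation may be strengthened. [folklore] -/
theorem ImplOn.of_subset (h : ImplOn P M U δ) (hP : P' ⊆ P) : ImplOn P' M U δ :=
  fun ψ hψ => h ψ (hψ.mono hP)

/-- Every matrix implements itself exactly. [folklore] -/
theorem ImplOn.refl (P : Set (Cryptography.QReg N)) (M : Matrix (Cryptography.QReg N) (Cryptography.QReg N) ℂ) : ImplOn P M M 0 :=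
  fun ψ _ => by rw [sub_self, l2Norm_zero, zero_mul]

/-- Exact equality gives an exact implementation. [folklore] -/
theorem ImplOn.of_eq (P : Set (Cryptography.QReg N)) (h : M = U) : ImplOn P M U 0 := h ▸ ImplOn.refl P M

/-- **Triangle inequality**: implementations compose transitively with added errors
(`E(U, W) ≤ E(U, V) + E(V, W)`). [cite: NielsenChuang2010, §4.5.3 Box 4.1] -/
theorem ImplOn.trans (h₁ : ImplOn P M U δ₁) (h₂ : ImplOn P U V δ₂) : ImplOn P M V (δ₁ + δ₂) := by
  intro ψ hψ
  calc l2Norm (M *ᵥ ψ - V *ᵥ ψ) ≤ l2Norm (M *ᵥ ψ - U *ᵥ ψ) + l2Norm (U *ᵥ ψ - V *ᵥ ψ) := l2Norm_sub_le _ _ _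
    _ ≤ δ₁ * l2Norm ψ + δ₂ * l2Norm ψ := add_le_add (h₁ ψ hψ) (h₂ ψ hψ)
    _ = (δ₁ + δ₂) * l2Norm ψ := by ring

/-- **Errors add along products** (Bernstein–Vazirani 1997, §6; Nielsen–Chuang eq. (4.63) for two
factors): if `M₁` implements `U₁` up to `δ₁` and `M₂` implements `U₂` up to `δ₂` on `P`, the actual
second factor is a contraction and the ideal first factor is a `P`-preserving contraction, then
`M₂ M₁` implements `U₂ U₁` up to `δ₁ + δ₂` on `P`:
`M₂M₁ψ − U₂U₁ψ = M₂(M₁ψ − U₁ψ) + (M₂ − U₂)(U₁ψ)`. [cite: NielsenChuang2010, §4.5.3 eq. (4.63)] [cite: BernsteinVazirani1997, §6] -/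
theorem ImplOn.mul (h₂ : ImplOn P M₂ U₂ δ₂) (h₁ : ImplOn P M₁ U₁ δ₁) (hM₂ : IsContraction M₂)
    (hU₁ : IsContraction U₁) (hPU₁ : PreservesSupp P U₁) (hδ₂ : 0 ≤ δ₂) :
    ImplOn P (M₂ * M₁) (U₂ * U₁) (δ₁ + δ₂) := by
  intro ψ hψ
  have e1 : (M₂ * M₁) *ᵥ ψ - (U₂ * U₁) *ᵥ ψ =
      M₂ *ᵥ (M₁ *ᵥ ψ - U₁ *ᵥ ψ) + (M₂ *ᵥ (U₁ *ᵥ ψ) - U₂ *ᵥ (U₁ *ᵥ ψ)) := by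
    rw [← Matrix.mulVec_mulVec, ← Matrix.mulVec_mulVec, Matrix.mulVec_sub]; abel
  rw [e1]
  calc l2Norm (M₂ *ᵥ (M₁ *ᵥ ψ - U₁ *ᵥ ψ) + (M₂ *ᵥ (U₁ *ᵥ ψ) - U₂ *ᵥ (U₁ *ᵥ ψ)))
      ≤ l2Norm (M₂ *ᵥ (M₁ *ᵥ ψ - U₁ *ᵥ ψ)) + l2Norm (M₂ *ᵥ (U₁ *ᵥ ψ) - U₂ *ᵥ (U₁ *ᵥ ψ)) := l2Norm_add_le _ _
    _ ≤ l2Norm (M₁ *ᵥ ψ - U₁ *ᵥ ψ) + δ₂ * l2Norm (U₁ *ᵥ ψ) := add_le_add (hM₂ _) (h₂ _ (hPU₁ ψ hψ))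
    _ ≤ δ₁ * l2Norm ψ + δ₂ * l2Norm ψ := add_le_add (h₁ ψ hψ) (mul_le_mul_of_nonneg_left (hU₁ ψ) hδ₂)
    _ = (δ₁ + δ₂) * l2Norm ψ := by ring

end Basic

/-! ### Lists of factors -/

section Lists

variable {P : Set (Cryptography.QReg N)}

/-- One step of an approximate circuit: the actual matrix, the ideal matrix, and the error bound.
[cite: NielsenChuang2010, §4.5.3] -/
structure ApproxStep (N : ℕ) where
  /-- the matrix actually applied -/
  act : Matrix (Cryptography.QReg N) (Cryptography.QReg N) ℂ
  /-- the ideal matrix it approximates -/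
  ideal : Matrix (Cryptography.QReg N) (Cryptography.QReg N) ℂ
  /-- the error bound -/
  err : ℝ

/-- A step is *good on `P`*: it is an implementation up to its (nonnegative) error, its actual
matrix is a contraction, its ideal matrix is a `P`-preserving contraction. [folklore] -/
structure ApproxStep.Good (P : Set (Cryptography.QReg N)) (s : ApproxStep N) : Prop where
  /-- the implementation bound -/
  implOn : ImplOn P s.act s.ideal s.err
  /-- the actual matrix is a contraction -/
  act_contr : IsContraction s.act
  /-- the ideal matrix is a contraction -/
  ideal_contr : IsContraction s.ideal
  /-- the ideal matrix preserves the support condition -/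
  ideal_pres : PreservesSupp P s.ideal
  /-- the error is nonnegative -/
  err_nonneg : 0 ≤ s.err

/-- A product of contractions (listed leftmost factor first) is a contraction. [folklore] -/
theorem isContraction_prod_map {L : List (ApproxStep N)} (h : ∀ s ∈ L, IsContraction s.act) :
    IsContraction (L.map ApproxStep.act).prod := by
  induction L with
  | nil => simpa using isContraction_one
  | cons s L ih =>
    rw [List.map_cons, List.prod_cons]
    exact (h s (by simp)).mul (ih fun t ht => h t (by simp [ht]))

/-- A product of contractions (ideal side) is a contraction. [folklore] -/
theorem isContraction_prod_map_ideal {L : List (ApproxStep N)} (h : ∀ s ∈ L, IsContraction s.ideal) :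
    IsContraction (L.map ApproxStep.ideal).prod := by
  induction L with
  | nil => simpa using isContraction_one
  | cons s L ih =>
    rw [List.map_cons, List.prod_cons]
    exact (h s (by simp)).mul (ih fun t ht => h t (by simp [ht]))

/-- A product of `P`-preserving matrices is `P`-preserving. [folklore] -/
theorem preservesSupp_prod_map_ideal {L : List (ApproxStep N)} (h : ∀ s ∈ L, PreservesSupp P s.ideal) :
    PreservesSupp P (L.map ApproxStep.ideal).prod := by
  induction L with
  | nil => simpa using preservesSupp_one P
  | cons s L ih =>
    rw [List.map_cons, List.prod_cons]
    exact (h s (by simp)).mul (ih fun t ht => h t (by simp [ht]))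

/-- **Errors add along a product of any length** (Bernstein–Vazirani 1997, §6; Nielsen–Chuang 2010,
eq. (4.63): `E(U_m ⋯ U_1, V_m ⋯ V_1) ≤ Σ_j E(U_j, V_j)`), in the clean-ancilla form: for a list of good
steps (leftmost factor first, i.e. applied last), the product of the actual matrices implements the
product of the ideal ones on `P` up to the sum of the errors. [cite: NielsenChuang2010, §4.5.3 eq. (4.63)] [cite: BernsteinVazirani1997, §6] -/
theorem ImplOn.listProd {L : List (ApproxStep N)} (h : ∀ s ∈ L, s.Good P) :
    ImplOn P (L.map ApproxStep.act).prod (L.map ApproxStep.ideal).prod (L.map ApproxStep.err).sum := by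
  induction L with
  | nil => simpa using ImplOn.refl P (1 : Matrix (Cryptography.QReg N) (Cryptography.QReg N) ℂ)
  | cons s L ih =>
    have hs := h s (by simp)
    have hL : ∀ t ∈ L, t.Good P := fun t ht => h t (by simp [ht])
    rw [List.map_cons, List.prod_cons, List.map_cons, List.prod_cons, List.map_cons, List.sum_cons, add_comm]
    exact hs.implOn.mul (ih hL) hs.act_contr (isContraction_prod_map_ideal fun t ht => (hL t ht).ideal_contr)
      (preservesSupp_prod_map_ideal fun t ht => (hL t ht).ideal_pres) hs.err_nonneg

end Lists

/-! ### Transport along a gate placement -/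

section Place

variable {k : ℕ}

/-- The placeFibre of a state vector over an assignment `r` of the wires off a placement `e`: the
`k`-qubit vector `j ↦ ψ(j on range e, r elsewhere)` (coordinates of `ψ` in the splitting
`QReg N ≃ QReg k × (off-wires → Bool)`, `splitWires`). [cite: NielsenChuang2010, §4.3] -/
def placeFibre (e : Fin k ↪ Fin N) (ψ : Cryptography.QReg N → ℂ) (r : ((Set.range e)ᶜ : Set (Fin N)) → Bool) :
    Cryptography.QReg k → ℂ :=
  fun j => ψ ((Cryptography.splitWires e).symm (j, r))

/-- Fibres are linear: subtraction. [folklore] -/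
@[simp] theorem placeFibre_sub (e : Fin k ↪ Fin N) (ψ φ : Cryptography.QReg N → ℂ) (r : ((Set.range e)ᶜ : Set (Fin N)) → Bool) :
    placeFibre e (ψ - φ) r = placeFibre e ψ r - placeFibre e φ r := rfl

/-- The selected wires of the label with coordinates `(j, r)` read `j`. [folklore] -/
theorem splitWires_symm_comp (e : Fin k ↪ Fin N) (j : Cryptography.QReg k) (r : ((Set.range e)ᶜ : Set (Fin N)) → Bool) :
    ((Cryptography.splitWires e).symm (j, r)) ∘ e = j := by
  have := Cryptography.splitWires_fst e ((Cryptography.splitWires e).symm (j, r))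
  rw [Equiv.apply_symm_apply] at this
  exact this.symm

/-- **A placed gate acts fibrewise**: the `(j, r)`-coordinate of `placeGate e A ψ` is
`(A · placeFibre r)(j)` — the matrix form of `(A ⊗ 1)(Σ_r ψ_r ⊗ |r⟩) = Σ_r (Aψ_r) ⊗ |r⟩`.
[cite: NielsenChuang2010, §4.3] -/
theorem placeFibre_placeGate_mulVec (e : Fin k ↪ Fin N) (A : Matrix (Cryptography.QReg k) (Cryptography.QReg k) ℂ)
    (ψ : Cryptography.QReg N → ℂ) (r : ((Set.range e)ᶜ : Set (Fin N)) → Bool) :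
    placeFibre e (Cryptography.placeGate e A *ᵥ ψ) r = A *ᵥ placeFibre e ψ r := by
  classical
  set s := Cryptography.splitWires e with hs
  funext j
  simp only [placeFibre]
  rw [Cryptography.placeGate_eq_reindex_kronecker_holds e A, Matrix.reindex_apply, Equiv.symm_symm,
    Matrix.mulVec, Matrix.mulVec, dotProduct, dotProduct]
  -- reindex the sum over labels by the splitting
  rw [← hs]
  have key : (∑ y, (A ⊗ₖ (1 : Matrix _ _ ℂ)).submatrix s s (s.symm (j, r)) y * ψ y) =
      ∑ p, (A ⊗ₖ (1 : Matrix _ _ ℂ)) (j, r) p * ψ (s.symm p) := by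
    refine Fintype.sum_equiv s _ _ fun y => ?_
    simp [Matrix.submatrix_apply]
  rw [key, Fintype.sum_prod_type]
  refine Finset.sum_congr rfl fun j' _ => ?_
  rw [Finset.sum_eq_single r]
  · simp [Matrix.kroneckerMap_apply, placeFibre, hs]
  · intro r' _ hr'
    simp [Matrix.kroneckerMap_apply, Matrix.one_apply_ne' hr']
  · simp

/-- **The squared norm is the sum of the squared norms of the fibres.** [folklore] -/
theorem normSq_eq_sum_normSq_placeFibre (e : Fin k ↪ Fin N) (ψ : Cryptography.QReg N → ℂ) :
    Cryptography.normSq ψ = ∑ r, Cryptography.normSq (placeFibre e ψ r) := by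
  set s := Cryptography.splitWires e with hs
  unfold Cryptography.normSq placeFibre
  rw [← Fintype.sum_equiv s.symm (fun p => ‖ψ (s.symm p)‖ ^ 2) (fun x => ‖ψ x‖ ^ 2) (fun p => rfl),
    Fintype.sum_prod_type, Finset.sum_comm]

/-- Fibres of a state supported on the pulled-back condition `{x | x ∘ e ∈ P}` are supported on `P`.
[folklore] -/
theorem suppIn_placeFibre (e : Fin k ↪ Fin N) {P : Set (Cryptography.QReg k)} {ψ : Cryptography.QReg N → ℂ}
    (h : SuppIn {x | x ∘ e ∈ P} ψ) (r : ((Set.range e)ᶜ : Set (Fin N)) → Bool) : SuppIn P (placeFibre e ψ r) := by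
  intro j hj
  simp only [placeFibre]
  apply h
  simp only [Set.mem_setOf_eq, splitWires_symm_comp]
  exact hj

/-- From `‖φ‖₂ ≤ δ ‖ψ‖₂` to `normSq φ ≤ δ² normSq ψ`. [folklore] -/
theorem normSq_le_of_l2Norm_le {M : ℕ} {φ ψ : Cryptography.QReg M → ℂ} {δ : ℝ} (h : l2Norm φ ≤ δ * l2Norm ψ) :
    Cryptography.normSq φ ≤ δ ^ 2 * Cryptography.normSq ψ := by
  rw [← l2Norm_sq, ← l2Norm_sq, ← mul_pow]
  exact pow_le_pow_left₀ (l2Norm_nonneg _) h 2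

/-- **Transport of an implementation along a placement**: if `M` implements `U` up to `δ` on
`P`-supported `k`-qubit inputs, then on any register the placed gate `placeGate e M` implements
`placeGate e U` up to the same `δ` on inputs supported on `{x | x ∘ e ∈ P}` (fibrewise estimate and
`‖ψ‖² = Σ_r ‖ψ_r‖²`; this is `E(A ⊗ 1, B ⊗ 1) = E(A, B)`). [cite: NielsenChuang2010, §4.5.3 and §4.3] -/
theorem ImplOn.placeGate (e : Fin k ↪ Fin N) {P : Set (Cryptography.QReg k)}
    {M U : Matrix (Cryptography.QReg k) (Cryptography.QReg k) ℂ} {δ : ℝ} (h : ImplOn P M U δ) (hδ : 0 ≤ δ) :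
    ImplOn {x | x ∘ e ∈ P} (Cryptography.placeGate e M) (Cryptography.placeGate e U) δ := by
  intro ψ hψ
  refine l2Norm_le_of_normSq_le (mul_nonneg hδ (l2Norm_nonneg ψ)) ?_
  rw [mul_pow, l2Norm_sq, normSq_eq_sum_normSq_placeFibre e, normSq_eq_sum_normSq_placeFibre e ψ, Finset.mul_sum]
  refine Finset.sum_le_sum fun r _ => ?_
  rw [placeFibre_sub, placeFibre_placeGate_mulVec, placeFibre_placeGate_mulVec]
  exact normSq_le_of_l2Norm_le (h _ (suppIn_placeFibre e hψ r))

/-- A placed contraction is a contraction. [cite: NielsenChuang2010, §4.3] -/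
theorem IsContraction.placeGate (e : Fin k ↪ Fin N) {M : Matrix (Cryptography.QReg k) (Cryptography.QReg k) ℂ}
    (h : IsContraction M) : IsContraction (Cryptography.placeGate e M) := by
  intro ψ
  rw [l2Norm_eq_sqrt_normSq, l2Norm_eq_sqrt_normSq]
  refine Real.sqrt_le_sqrt ?_
  rw [normSq_eq_sum_normSq_placeFibre e, normSq_eq_sum_normSq_placeFibre e ψ]
  refine Finset.sum_le_sum fun r _ => ?_
  rw [placeFibre_placeGate_mulVec, ← l2Norm_sq, ← l2Norm_sq]
  exact pow_le_pow_left₀ (l2Norm_nonneg _) (h _) 2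

/-- A placed gate preserves the pulled-back support condition if the gate preserves the original
one. [folklore] -/
theorem PreservesSupp.placeGate (e : Fin k ↪ Fin N) {P : Set (Cryptography.QReg k)}
    {U : Matrix (Cryptography.QReg k) (Cryptography.QReg k) ℂ} (h : PreservesSupp P U) :
    PreservesSupp {x | x ∘ e ∈ P} (Cryptography.placeGate e U) := by
  intro ψ hψ x hx
  have hfib := h _ (suppIn_placeFibre e hψ (Cryptography.splitWires e x).2) (Cryptography.splitWires e x).1 (by
    simp only [Set.mem_setOf_eq] at hx
    rwa [Cryptography.splitWires_fst])
  rw [← placeFibre_placeGate_mulVec] at hfib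
  simp only [placeFibre, Prod.mk.eta, Equiv.symm_apply_apply] at hfib
  exact hfib

/-- **A placed gate preserves every support condition that only reads wires off its placement**
(e.g. "these ancillas, disjoint from the gate, are `0`"). [cite: NielsenChuang2010, §4.3] -/
theorem preservesSupp_placeGate_of_offWires (e : Fin k ↪ Fin N) {P : Set (Cryptography.QReg N)}
    (hP : ∀ x y : Cryptography.QReg N, (∀ i, i ∉ Set.range e → x i = y i) → (x ∈ P ↔ y ∈ P))
    (A : Matrix (Cryptography.QReg k) (Cryptography.QReg k) ℂ) : PreservesSupp P (Cryptography.placeGate e A) := by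
  intro ψ hψ x hx
  rw [Matrix.mulVec, dotProduct]
  refine Finset.sum_eq_zero fun y _ => ?_
  rw [Cryptography.placeGate_apply]
  split_ifs with hxy
  · rw [hψ y fun hy => hx ((hP x y hxy).2 hy), mul_zero]
  · rw [zero_mul]

end Place

/-! ### Statistics -/

section Stats

variable {P : Set (Cryptography.QReg N)} {M U : Matrix (Cryptography.QReg N) (Cryptography.QReg N) ℂ} {δ : ℝ}

/-- **Approximately implemented unitaries have approximately the same statistics**: if `M`
implements `U` up to `δ` on `P`, both are unitary, and `ψ` is a `P`-supported unit vector, then every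
event `E` has `|Σ_{x∈E} |(Mψ)(x)|² − Σ_{x∈E} |(Uψ)(x)|²| ≤ δ` (Nielsen–Chuang eq. (4.62) with the sharp
one-event constant of BBBV Thm. 3.1). [cite: NielsenChuang2010, §4.5.3 eq. (4.62)] [cite: BennettBernsteinBrassardVazirani1997, Thm. 3.1] -/
theorem abs_sum_normSq_sub_le_of_implOn (hM : M ∈ Matrix.unitaryGroup (Cryptography.QReg N) ℂ)
    (hU : U ∈ Matrix.unitaryGroup (Cryptography.QReg N) ℂ) (h : ImplOn P M U δ) {ψ : Cryptography.QReg N → ℂ}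
    (hψ : SuppIn P ψ) (hψ1 : Cryptography.normSq ψ = 1) (E : Finset (Cryptography.QReg N)) :
    |∑ x ∈ E, ‖(M *ᵥ ψ) x‖ ^ 2 - ∑ x ∈ E, ‖(U *ᵥ ψ) x‖ ^ 2| ≤ δ := by
  have h1 : l2Norm ψ = 1 := by rw [l2Norm_eq_sqrt_normSq, hψ1, Real.sqrt_one]
  calc |∑ x ∈ E, ‖(M *ᵥ ψ) x‖ ^ 2 - ∑ x ∈ E, ‖(U *ᵥ ψ) x‖ ^ 2|
      ≤ l2Norm (M *ᵥ ψ - U *ᵥ ψ) :=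
        abs_sum_normSq_sub_le (by rw [Cryptography.normSq_mulVec_of_mem_unitaryGroup hM, hψ1])
          (by rw [Cryptography.normSq_mulVec_of_mem_unitaryGroup hU, hψ1]) E
    _ ≤ δ * l2Norm ψ := h ψ hψ
    _ = δ := by rw [h1, mul_one]

end Stats

end Literature.Computability.QuantumComplexity

end
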